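import Literature.NumberTheory.GaloisCohomology.PoitouTateSelmerCountProofs
import HarnessLib

/-!
# Poitou–Tate for Selmer structures: LIFTING A LOCAL CHARACTER AT ONE PLACE to a global Selmer class
# (Milne ADT I Thm. 4.10(b) `⊇` / Howard 2004 Thm. 2.1.11, the one-place «deep half»)

`Proofs` file (theorems only: no definition, no named fact, debt `0`), topic `NumberTheory/GaloisCohomology`
(namespace = path), continuing `PoitouTateSelmerStructures.lean` / `PoitouTateSelmerCountProofs.lean`.

## What is proved

Let `inv` be a family of local invariant maps with `IsPerfect` and `SelmerComplement` (the properties of THE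
invariant maps: for the canonical family `LocalInvariants.canonical K n` the first is the kernel theorem
`canonical_isPerfect`, the second is Milne I Thm. 4.10(b) `⊇`), `M` a finite discrete `Γ_K`-module killed by
`n ≥ 1`, `S ∋ v₀` a finite set of places as in Howard's Def. 2.1.10, and `𝓕 ≤ 𝓖` Selmer structures on `M`
unramified outside `S` with `𝓖_{v₀} = H¹(K_{v₀}, M)` (relaxed) and `𝓕_{v₀} = C^⊥` the annihilator of a subgroup
`C ≤ H¹(K_{v₀}, M^D)` under the local Tate pairing `⟨·,·⟩_{v₀}`.

* `AddMonoidHom.exists_comp_subtype_eq_of_nsmul_eq_zero` — every `ℤ/n`-valued character of a subgroup of a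
  finite abelian group killed by `n` extends to the whole group (counting: `#Hom(A, ℤ/n) = #A`, Milne I §0 (0.19)).
* `SelmerComplement.exists_selmer_localTatePairing_eq` — **one-place lift of a character**: if a character
  `χ : H¹(K_{v₀}, M^D) → ℤ/n` kills `loc_{v₀} H¹_{𝓕*}(K, M^D)`, there is a global class `x ∈ H¹_𝓖(K, M)` with
  `⟨loc_{v₀} x, c⟩_{v₀} = χ(c)` for every `c ∈ C`, and `loc_v x ∈ 𝓕_v` at the other `v ∈ S`. (Proof: `χ = ⟨t, ·⟩` by
  perfectness; the family `(t at v₀, 0 elsewhere)` is orthogonal to `H¹_{𝓕*}`; `SelmerComplement` (i).)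
* `SelmerComplement.exists_selmer_localTatePairing_eq_of_subgroup` — the same for a character `χ : C → ℤ/n` of the
  SUBGROUP that kills `C ∩ loc_{v₀} H¹_{𝓕*}(K, M^D)`; here `loc_{v₀} H¹_{𝓕*} ⊆ 𝓕*_{v₀} = C^{⊥⊥} = C` by the double
  annihilator (`mem_of_forall_annihilator_eq_zero`), and `χ` is first extended to `H¹(K_{v₀}, M^D)`.

This is the shape in which the existence half of Poitou–Tate is consumed when a LOCAL functional (e.g. on
`E(K_{v₀}) ⊗ ℤ/p^k`, through the Kummer map) that is orthogonal to the localisations of a dual Selmer group is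
lifted to a global cohomology class with prescribed local pairing values — Kobayashi 2003 (7.17)–(7.20) /
B. D. Kim 2013 Prop. 3.8 at finite level, Greenberg LNM 1716 §4.

## References

* J. S. Milne, *Arithmetic Duality Theorems*, 2nd ed. (2006), Ch. I §0 (0.19), Cor. 2.3, Thm. 4.10(b). [MilneADT2006]
* B. Howard, Compositio Math. 140 (2004), Def. 2.1.6, Def. 2.1.10, Thm. 2.1.11. [Howard2004HeegnerKolyvagin]
* S. Kobayashi, Invent. Math. 152 (2003), (7.17)–(7.20), Thm. 7.3. [Kobayashi2003]
* B. D. Kim, J. Aust. Math. Soc. 95 (2013), Prop. 3.4, Prop. 3.8.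
-/

noncomputable section

open Function NumberField IsDedekindDomain
open scoped NumberField

universe u

/-! ### §1 Extension of `ℤ/n`-valued characters from a subgroup (finite groups killed by `n`) -/

open Literature.NumberTheory.GaloisRepresentations in
/-- **Every `ℤ/n`-valued character of a subgroup of a finite abelian group killed by `n` extends to the whole
group.** Counting proof: the restriction map `Hom(A, ℤ/n) → Hom(B, ℤ/n)` has kernel of order `≤ #Hom(A/B, ℤ/n)
= #(A/B)` and source of order `#A = #(A/B)·#B`, so its image has order `≥ #B = #Hom(B, ℤ/n)`.
[cite: MilneADT2006, Ch. I §0 Prop. 0.19] -/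
theorem AddMonoidHom.exists_comp_subtype_eq_of_nsmul_eq_zero {A : Type u} [AddCommGroup A] [Finite A]
    {n : ℕ} [NeZero n] (hA : ∀ a : A, n • a = 0) (B : AddSubgroup A) (χ : B →+ ZMod n) :
    ∃ χ' : A →+ ZMod n, ∀ b : B, χ' b = χ b := by
  classical
  have hB : ∀ b : B, n • b = 0 := fun b ↦ Subtype.ext (by
    rw [AddSubgroup.coe_nsmul, hA, AddSubgroup.coe_zero])
  have hQ : ∀ q : A ⧸ B, n • q = 0 := fun q ↦ by
    induction q using QuotientAddGroup.induction_on with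
    | H z => rw [← QuotientAddGroup.mk_nsmul, hA z, QuotientAddGroup.mk_zero]
  haveI hfA : Finite (A →+ ZMod n) := Finite.of_injective (fun f : A →+ ZMod n ↦ (f : A → ZMod n)) DFunLike.coe_injective
  haveI hfB : Finite (B →+ ZMod n) := Finite.of_injective (fun f : B →+ ZMod n ↦ (f : B → ZMod n)) DFunLike.coe_injective
  haveI hfQ : Finite (A ⧸ B →+ ZMod n) :=
    Finite.of_injective (fun f : A ⧸ B →+ ZMod n ↦ (f : A ⧸ B → ZMod n)) DFunLike.coe_injective
  -- the restriction map
  let r : (A →+ ZMod n) →+ (B →+ ZMod n) :=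
    { toFun := fun f ↦ f.comp B.subtype
      map_zero' := by ext; rfl
      map_add' := fun _ _ ↦ by ext; rfl }
  have hr : ∀ f : A →+ ZMod n, r f = f.comp B.subtype := fun _ ↦ rfl
  -- its kernel injects into `Hom(A/B, ℤ/n)`
  have hker : Nat.card r.ker ≤ Nat.card (A ⧸ B →+ ZMod n) := by
    have hvan : ∀ f : r.ker, ∀ b ∈ B, (f : A →+ ZMod n) b = 0 := fun f b hb ↦ by
      have h0 : r f = 0 := (AddMonoidHom.mem_ker).1 f.2
      have := DFunLike.congr_fun h0 ⟨b, hb⟩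
      rwa [hr, AddMonoidHom.comp_apply, AddSubgroup.coe_subtype, AddMonoidHom.zero_apply] at this
    refine Nat.card_le_card_of_injective (fun f ↦ QuotientAddGroup.lift B (f : A →+ ZMod n) (hvan f)) ?_
    intro f g hfg
    apply Subtype.ext
    ext a
    have := DFunLike.congr_fun hfg (QuotientAddGroup.mk a)
    simpa only [QuotientAddGroup.lift_mk] using this
  -- counting
  have cA : Nat.card (A →+ ZMod n) = Nat.card A := Nat.card_addMonoidHom_zmod hA
  have cB : Nat.card (B →+ ZMod n) = Nat.card B := Nat.card_addMonoidHom_zmod hB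
  have cQ : Nat.card (A ⧸ B →+ ZMod n) = Nat.card (A ⧸ B) := Nat.card_addMonoidHom_zmod hQ
  have c1 : Nat.card (A →+ ZMod n) = Nat.card ((A →+ ZMod n) ⧸ r.ker) * Nat.card r.ker :=
    AddSubgroup.card_eq_card_quotient_mul_card_addSubgroup r.ker
  have c2 : Nat.card ((A →+ ZMod n) ⧸ r.ker) = Nat.card r.range :=
    Nat.card_congr (QuotientAddGroup.quotientKerEquivRange r).toEquiv
  have c3 : Nat.card A = Nat.card (A ⧸ B) * Nat.card B := AddSubgroup.card_eq_card_quotient_mul_card_addSubgroup B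
  have hQpos : 0 < Nat.card (A ⧸ B) := Nat.card_pos
  have hrange : Nat.card (B →+ ZMod n) ≤ Nat.card r.range := by
    have h1 : Nat.card (A ⧸ B) * Nat.card B ≤ Nat.card r.range * Nat.card (A ⧸ B) := by
      calc Nat.card (A ⧸ B) * Nat.card B = Nat.card r.range * Nat.card r.ker := by rw [← c3, ← cA, c1, c2]
        _ ≤ Nat.card r.range * Nat.card (A ⧸ B) := Nat.mul_le_mul_left _ (hker.trans cQ.le)
    rw [cB]
    rw [mul_comm] at h1
    exact Nat.le_of_mul_le_mul_right h1 hQpos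
  have htop : r.range = ⊤ := AddSubgroup.eq_top_of_le_card _ hrange
  have hχ : χ ∈ r.range := htop ▸ AddSubgroup.mem_top χ
  obtain ⟨χ', hχ'⟩ := hχ
  exact ⟨χ', fun b ↦ by rw [← hχ', hr, AddMonoidHom.comp_apply, AddSubgroup.coe_subtype]⟩

namespace Literature.NumberTheory.GaloisCohomology

open Literature.NumberTheory.GaloisRepresentations
open Literature.NumberTheory.GaloisRepresentations.DiscreteGaloisModule (localTatePairingZMod tateDual
  SelmerStructure)

variable {K : Type u} [Field K] [NumberField K]

namespace LocalInvariants

variable {n : ℕ} {M : Type u} [AddCommGroup M] [TopologicalSpace M] [DiscreteTopology M] [Finite M]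

/-! ### §2 Lifting a character of `H¹(K_{v₀}, M^D)` orthogonal to `loc_{v₀} H¹_{𝓕*}(K, M^D)` -/

/-- **One-place lift of a local character (Milne I 4.10(b) `⊇` through `SelmerComplement`).** Hypotheses: `inv`
with `IsPerfect` and `SelmerComplement`; `M` finite killed by `n`; `S`, `𝓕 ≤ 𝓖` unramified outside `S` as in
`SelmerComplement`; `v₀ ∈ S` finite with `𝓖_{v₀} = ⊤` and `𝓕_{v₀} = C^⊥` (annihilator of `C ≤ H¹(K_{v₀}, M^D)`); a
character `χ` of `H¹(K_{v₀}, M^D)` killing `loc_{v₀} y` for every `y ∈ H¹_{𝓕*}(K, M^D)`. Conclusion: some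
`x ∈ H¹_𝓖(K, M)` has `⟨loc_{v₀} x, c⟩_{v₀} = χ c` on `C` and `loc_v x ∈ 𝓕_v` at the other `v ∈ S`.
[cite: MilneADT2006, Ch. I, Thm. 4.10(b)] [cite: Howard2004HeegnerKolyvagin, Thm. 2.1.11 (arXiv:1202.6340 p. 6)] -/
theorem SelmerComplement.exists_selmer_localTatePairing_eq {inv : LocalInvariants K n}
    (hperf : inv.IsPerfect) (h : inv.SelmerComplement) (ρ : DiscreteGaloisModule K M)
    (hM : ∀ m : M, n • m = 0) {S : Finset (Place K)}
    (hS : ∀ v : HeightOneSpectrum (𝓞 K), (Sum.inr v : Place K) ∉ S →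
      ((n : ℕ) : 𝓞 K) ∉ v.asIdeal ∧ GaloisRep.IsUnramifiedAt v ρ)
    {𝓕 𝓖 : SelmerStructure ρ} (hle : 𝓕 ≤ 𝓖) (h𝓕 : 𝓕.IsUnramifiedOutside S)
    (h𝓖 : 𝓖.IsUnramifiedOutside S) {v₀ : HeightOneSpectrum (𝓞 K)} (hv₀ : (Sum.inr v₀ : Place K) ∈ S)
    (h𝓖v : 𝓖 (Sum.inr v₀) = ⊤)
    (C : AddSubgroup (galoisCohomology ((ρ.tateDual n).toLocal (Sum.inr v₀)) 1))
    (h𝓕v : ∀ a, a ∈ 𝓕 (Sum.inr v₀) ↔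
      ∀ c ∈ C, localTatePairingZMod ρ n (Sum.inr v₀) (inv (Sum.inr v₀)) a c = 0)
    (χ : galoisCohomology ((ρ.tateDual n).toLocal (Sum.inr v₀)) 1 →+ ZMod n)
    (hχ : ∀ y ∈ (inv.dualSelmerStructure ρ 𝓕).selmerGroup,
      χ (galoisCohomology.localization (ρ.tateDual n) (Sum.inr v₀) 1 y) = 0) :
    ∃ x ∈ 𝓖.selmerGroup,
      (∀ c ∈ C, localTatePairingZMod ρ n (Sum.inr v₀) (inv (Sum.inr v₀))
        (galoisCohomology.localization ρ (Sum.inr v₀) 1 x) c = χ c) ∧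
      ∀ v ∈ S, v ≠ Sum.inr v₀ → galoisCohomology.localization ρ v 1 x ∈ 𝓕 v := by
  classical
  -- (1) `χ = ⟨t, ·⟩_{v₀}` for some `t ∈ H¹(K_{v₀}, M)` (perfectness: `a ↦ ⟨a, ·⟩` is onto)
  obtain ⟨t, ht⟩ := ((hperf v₀).2 ρ hM).1.2 χ
  -- (2) the family supported at `v₀`
  set tf : Π v : Place K, galoisCohomology (ρ.toLocal v) 1 := Pi.single (Sum.inr v₀) t with htf
  have htf𝓖 : ∀ v ∈ S, tf v ∈ 𝓖 v := fun v _ ↦ by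
    by_cases hv : v = Sum.inr v₀
    · subst hv; rw [htf, Pi.single_eq_same, h𝓖v]; exact AddSubgroup.mem_top _
    · rw [htf, Pi.single_eq_of_ne hv]; exact zero_mem _
  have horth : ∀ y ∈ (inv.dualSelmerStructure ρ 𝓕).selmerGroup,
      ∑ v ∈ S, localTatePairingZMod ρ n v (inv v) (tf v)
        (galoisCohomology.localization (ρ.tateDual n) v 1 y) = 0 := by
    intro y hy
    rw [Finset.sum_eq_single (Sum.inr v₀)]
    · rw [htf, Pi.single_eq_same, ht]; exact hχ y hy
    · intro v _ hv; rw [htf, Pi.single_eq_of_ne hv, map_zero, AddMonoidHom.zero_apply]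
    · intro hv; exact absurd hv₀ hv
  -- (3) Poitou–Tate, existence half
  obtain ⟨x, hx, hxt⟩ := (h ρ hM S hS 𝓕 𝓖 hle h𝓕 h𝓖).1 tf htf𝓖 horth
  refine ⟨x, hx, fun c hc ↦ ?_, fun v hv hne ↦ ?_⟩
  · have h1 := hxt (Sum.inr v₀) hv₀
    rw [htf, Pi.single_eq_same, h𝓕v] at h1
    have h2 := h1 c hc
    rw [map_sub, AddMonoidHom.sub_apply, sub_eq_zero] at h2
    rw [h2, ht]
  · have h1 := hxt v hv
    rwa [htf, Pi.single_eq_of_ne hne, sub_zero] at h1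

/-! ### §3 The same for a character of the subgroup `C` killing `C ∩ loc_{v₀} H¹_{𝓕*}(K, M^D)` -/

/-- **One-place lift of a character of the subgroup.** As `exists_selmer_localTatePairing_eq`, for a character
`χ : C → ℤ/n` (with `n ≥ 1`) that kills every `loc_{v₀} y ∈ C`, `y ∈ H¹_{𝓕*}(K, M^D)`: some `x ∈ H¹_𝓖(K, M)` has
`⟨loc_{v₀} x, c⟩_{v₀} = χ c` for all `c ∈ C` (and `loc_v x ∈ 𝓕_v` at the other `v ∈ S`). Proof: `loc_{v₀} y ∈ 𝓕*_{v₀}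
= C^{⊥⊥} = C` (double annihilator for the perfect local pairing on the finite groups `H¹(K_{v₀}, M)`,
`H¹(K_{v₀}, M^D)`), extend `χ` to `H¹(K_{v₀}, M^D)`, and apply §2.
[cite: MilneADT2006, Ch. I, §0 Prop. 0.19, Cor. 2.3, Thm. 4.10(b)] [cite: Howard2004HeegnerKolyvagin, Thm. 2.1.11 (arXiv:1202.6340 p. 6)] -/
theorem SelmerComplement.exists_selmer_localTatePairing_eq_of_subgroup [NeZero n] {inv : LocalInvariants K n}
    (hperf : inv.IsPerfect) (h : inv.SelmerComplement) (ρ : DiscreteGaloisModule K M)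
    (hM : ∀ m : M, n • m = 0) {S : Finset (Place K)}
    (hS : ∀ v : HeightOneSpectrum (𝓞 K), (Sum.inr v : Place K) ∉ S →
      ((n : ℕ) : 𝓞 K) ∉ v.asIdeal ∧ GaloisRep.IsUnramifiedAt v ρ)
    {𝓕 𝓖 : SelmerStructure ρ} (hle : 𝓕 ≤ 𝓖) (h𝓕 : 𝓕.IsUnramifiedOutside S)
    (h𝓖 : 𝓖.IsUnramifiedOutside S) {v₀ : HeightOneSpectrum (𝓞 K)} (hv₀ : (Sum.inr v₀ : Place K) ∈ S)
    (h𝓖v : 𝓖 (Sum.inr v₀) = ⊤)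
    (C : AddSubgroup (galoisCohomology ((ρ.tateDual n).toLocal (Sum.inr v₀)) 1))
    (h𝓕v : ∀ a, a ∈ 𝓕 (Sum.inr v₀) ↔
      ∀ c ∈ C, localTatePairingZMod ρ n (Sum.inr v₀) (inv (Sum.inr v₀)) a c = 0)
    (χ : C →+ ZMod n)
    (hχ : ∀ y ∈ (inv.dualSelmerStructure ρ 𝓕).selmerGroup,
      ∀ hy : galoisCohomology.localization (ρ.tateDual n) (Sum.inr v₀) 1 y ∈ C,
        χ ⟨galoisCohomology.localization (ρ.tateDual n) (Sum.inr v₀) 1 y, hy⟩ = 0) :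
    ∃ x ∈ 𝓖.selmerGroup,
      (∀ (c) (hc : c ∈ C), localTatePairingZMod ρ n (Sum.inr v₀) (inv (Sum.inr v₀))
        (galoisCohomology.localization ρ (Sum.inr v₀) 1 x) c = χ ⟨c, hc⟩) ∧
      ∀ v ∈ S, v ≠ Sum.inr v₀ → galoisCohomology.localization ρ v 1 x ∈ 𝓕 v := by
  classical
  haveI := finite_galoisCohomology_one_toLocal ρ v₀
  haveI := finite_galoisCohomology_one_tateDual_toLocal ρ n v₀
  -- both local groups are killed by `n`
  have hAn : ∀ a : galoisCohomology (ρ.toLocal (Sum.inr v₀)) 1, n • a = 0 :=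
    galoisCohomology.nsmul_eq_zero_of_forall _ hM
  have hBn : ∀ b : galoisCohomology ((ρ.tateDual n).toLocal (Sum.inr v₀)) 1, n • b = 0 :=
    galoisCohomology.nsmul_eq_zero_of_forall _ fun f ↦ DiscreteGaloisModule.TateDual.nsmul_eq_zero f
  -- the local pairing and its perfectness
  set P := localTatePairingZMod ρ n (Sum.inr v₀) (inv (Sum.inr v₀)) with hP
  have hPbij : Bijective P ∧ Bijective P.flip := (hperf v₀).2 ρ hM
  have hPff : P.flip.flip = P := by ext; rfl
  -- `loc_{v₀} y ∈ C` for `y ∈ H¹_{𝓕*}` (double annihilator)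
  have hlocC : ∀ y ∈ (inv.dualSelmerStructure ρ 𝓕).selmerGroup,
      galoisCohomology.localization (ρ.tateDual n) (Sum.inr v₀) 1 y ∈ C := by
    intro y hy
    have hy' := (SelmerStructure.mem_selmerGroup_iff _ y).mp hy (Sum.inr v₀)
    rw [dualSelmerStructure_apply, mem_dualLocalCondition_iff] at hy'
    refine mem_of_forall_annihilator_eq_zero hBn hAn P.flip hPbij.2 (hPff ▸ hPbij.1) C (𝓕 (Sum.inr v₀))
      (fun a ↦ ?_) _ fun a ha ↦ ?_
    · simpa only [AddMonoidHom.flip_apply] using h𝓕v a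
    · rw [AddMonoidHom.flip_apply]; exact hy' a ha
  -- extend `χ` and apply §2
  obtain ⟨χ', hχ'⟩ := AddMonoidHom.exists_comp_subtype_eq_of_nsmul_eq_zero hBn C χ
  obtain ⟨x, hx, hval, hrest⟩ := h.exists_selmer_localTatePairing_eq hperf ρ hM hS hle h𝓕 h𝓖 hv₀ h𝓖v C h𝓕v χ'
    fun y hy ↦ (hχ' ⟨_, hlocC y hy⟩).trans (hχ y hy (hlocC y hy))
  exact ⟨x, hx, fun c hc ↦ (hval c hc).trans (hχ' ⟨c, hc⟩), hrest⟩

end LocalInvariants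

end Literature.NumberTheory.GaloisCohomology

end
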